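import Literature.AlgebraicGeometry.Motives.GrassmannianChartScheme
import Literature.AlgebraicGeometry.Motives.GrassmannianChartsCover
import Mathlib.AlgebraicGeometry.Gluing
import HarnessLib

/-!
# The standard charts of the Grassmannian scheme: `chartMap I` is injective and the charts cover the field points

Topic `Literature/AlgebraicGeometry/Motives`; namespace `Literature.AlgebraicGeometry.Motives.Grassmannian`.  PROOF-lane sequel of the objects file
`GrassmannianChartScheme` ((A3.1) `chartScheme`, (A3.2) `chartElem`/`chartMap`); cell hodgecm-mathlib key (h4), (A3)/(A4) INTERFACE MEMO
(`A34-INTERFACE.B-p21g15.md`): this file is (A3.3) and (A3.6) (B-p18 (g17)); (A3.4)/(A3.5) are B-p09 (g12)'s `GrassmannianChartLocusScheme`,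
the generic (A3.5c) is B-p21's `SubsheafRangeOfBijectiveOnSpec`, (A4) is B-p21's one-line assembly.  THEOREMS ONLY.

* `chartRingHom_chartVar`, `chartRing_hom_ext`, `chartRingHom_apply_chartVar`, `exists_eq_specMap` — plumbing for `ℤ[X]` and `Spec`;
* `chartCoordMap_frame`, `chartElemAffine_mem_chart`, `specEquiv_chartElem`;
* **`specEquiv_map_chartElem`** — on `Spec A`: `specEquiv (Gr(Spec φ) chartElem) = ofCoordMap (b ∘ I) (columns φ(X))` ((C4)-naturality
  ★ `map_ofCoordMap`, ★ `compLeft_comp_coordMapOfColumns`); `specEquiv_chartMap_app_specMap`;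
* (A3.3) `specMap_injective_of_map_chartElem_eq`, `chartMap_app_injective_Spec`, **`chartMap_app_injective (T)`** — on `Spec A` by (C4)
  (★ `ofCoordMap_injective`, ★ `restrict_coordMapOfColumns`) and `chartRing_hom_ext`; in general by the affine cover and `Scheme.Cover.hom_ext`;
* (A3.6) `mem_range_chartMap_app_Spec_of_mem_chart`, **`exists_mem_range_chartMap_app_of_field (K) [Field K] (x : Gr(Spec K))`** — (C5) ★
  `exists_mem_chart_of_field` + (C4) — the `hcover` binder of ★ `isRepresentable_of_openCondition_cover` verbatim.

[Stacks 089T]; EGA I (1971) 9.7.4; [EisenbudHarris2016, §3.2.2]; [GortzWedhorn2020, (8.4)–(8.6)].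
HC_CM is proved only modulo the 7 printed citations until rung 0 closes; nothing here is about HC.
-/

noncomputable section

namespace Literature.AlgebraicGeometry.Motives.Grassmannian

open CategoryTheory Opposite TensorProduct _root_.AlgebraicGeometry

universe u

/-! ## §1 Plumbing for the chart ring -/

section ChartScheme

variable (k : ℕ) {J : Type u}

/-- Evaluation sends `X_p` to `v p`. [cite: StacksProject, Tag 089T] -/
theorem chartRingHom_chartVar (I : Fin k → J) {A : CommRingCat.{u}} (v : {j : J // j ∉ Set.range I} × Fin k → A)
    (p : {j : J // j ∉ Set.range I} × Fin k) : chartRingHom k I v (chartVar k I p) = v p :=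
  MvPolynomial.eval₂Hom_X' _ _ _

/-- Ring maps out of `ℤ[X_p]` are determined by their values on the variables. [cite: StacksProject, Tag 089T] -/
theorem chartRing_hom_ext (I : Fin k → J) {A : CommRingCat.{u}} {f g : chartRing k I ⟶ A}
    (h : ∀ p, f (chartVar k I p) = g (chartVar k I p)) : f = g :=
  CommRingCat.hom_ext (MvPolynomial.ringHom_ext' (Subsingleton.elim _ _) h)

/-- The evaluation map with values `φ(X_p)` is `φ`. [cite: StacksProject, Tag 089T] -/
theorem chartRingHom_apply_chartVar (I : Fin k → J) {A : CommRingCat.{u}} (φ : chartRing k I ⟶ A) :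
    chartRingHom k I (fun p => φ (chartVar k I p)) = φ :=
  chartRing_hom_ext k I fun p => chartRingHom_chartVar k I _ p

/-- Every morphism `Spec A ⟶ chartScheme` is `Spec` of a ring map (`Spec` is fully faithful). [cite: StacksProject, Tag 089T] -/
theorem exists_eq_specMap (I : Fin k → J) {A : CommRingCat.{u}} (g : Spec A ⟶ chartScheme k I) :
    ∃ φ : chartRing k I ⟶ A, g = Spec.map φ :=
  ⟨Spec.preimage g, (Spec.map_preimage g).symm⟩

end ChartScheme

/-! ## §2 The universal chart element in affine coordinates -/

section ChartMap

variable (k : ℕ) (M : Type u) [AddCommGroup M] {J : Type u} (b : Module.Basis J ℤ M)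

/-- The universal coordinate map is normalised on the frame `b ∘ I` (`I` injective). [cite: StacksProject, Tag 089T] -/
theorem chartCoordMap_frame (I : Fin k → J) (hI : Function.Injective I) (i : Fin k) :
    chartCoordMap k M b I ((⇑b ∘ I) i) = Pi.single i 1 :=
  coordMapOfColumns_frame b I hI _ i

/-- The universal chart point lies in the chart `U_I(ℤ[X])`. [cite: StacksProject, Tag 089T] -/
theorem chartElemAffine_mem_chart (I : Fin k → J) (hI : Function.Injective I) :
    chartElemAffine k M b I hI ∈ chart ℤ M k (⇑b ∘ I) (chartRing k I) :=
  ofCoordMap_mem_chart _ _ _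

/-- `specEquiv` of the universal chart element is the affine universal point. [cite: StacksProject, Tag 089T] -/
@[simp]
theorem specEquiv_chartElem (I : Fin k → J) (hI : Function.Injective I) :
    specEquiv M k (chartRing k I) (chartElem k M b I hI) = chartElemAffine k M b I hI :=
  Equiv.apply_symm_apply _ _

/-- **The chart map on `Spec A`, in affine coordinates**: for a ring map `φ : ℤ[X] → A`, the point `Gr(Spec φ) chartElem` of `Gr(Spec A)`
is, under `specEquiv`, the chart point whose free columns are the values `φ(X_{(j,i)})` (★ `map_ofCoordMap`, ★ `compLeft_comp_coordMapOfColumns`).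
[cite: StacksProject, Tag 089T] [cite: EisenbudHarris2016, §3.2.2] -/
theorem specEquiv_map_chartElem (I : Fin k → J) (hI : Function.Injective I) {A : CommRingCat.{u}} (φ : chartRing k I ⟶ A) :
    specEquiv M k A ((grassmannianSheaf M k).obj.map (Spec.map φ).op (chartElem k M b I hI)) =
      ofCoordMap (⇑b ∘ I) (coordMapOfColumns b I fun j i => φ (chartVar k I (j, i))) (coordMapOfColumns_frame b I hI _) := by
  rw [specEquiv_naturality, specEquiv_chartElem, chartElemAffine, map_ofCoordMap]
  refine ofCoordMap_congr _ ?_ _ _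
  rw [chartCoordMap, compLeft_comp_coordMapOfColumns _ b I hI]
  rfl

/-- The chart map on `Spec A` applied to `Spec φ`, in affine coordinates. [cite: StacksProject, Tag 089T] -/
theorem specEquiv_chartMap_app_specMap (I : Fin k → J) (hI : Function.Injective I) {A : CommRingCat.{u}} (φ : chartRing k I ⟶ A) :
    specEquiv M k A ((chartMap k M b I hI).app (op (Spec A)) (Spec.map φ)) =
      ofCoordMap (⇑b ∘ I) (coordMapOfColumns b I fun j i => φ (chartVar k I (j, i))) (coordMapOfColumns_frame b I hI _) := by
  rw [chartMap_app_apply, specEquiv_map_chartElem]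

end ChartMap

/-! ## §3 (A3.3) The chart map is injective on `T`-points -/

section Injective

variable (k : ℕ) (M : Type u) [AddCommGroup M] {J : Type u} (b : Module.Basis J ℤ M)

/-- **Injectivity on affine schemes**: `φ ↦ Gr(Spec φ) chartElem` is injective in the ring map `φ : ℤ[X] → A` — the columns `φ(X)`
are recovered as the free columns of the coordinate map ((C4): ★ `coordMap_ofCoordMap`, ★ `restrict_coordMapOfColumns`), and they
determine `φ`. [cite: StacksProject, Tag 089T] [cite: EisenbudHarris2016, §3.2.2] -/
theorem specMap_injective_of_map_chartElem_eq (I : Fin k → J) (hI : Function.Injective I) {A : CommRingCat.{u}}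
    {φ φ' : chartRing k I ⟶ A}
    (h : (grassmannianSheaf M k).obj.map (Spec.map φ).op (chartElem k M b I hI) =
      (grassmannianSheaf M k).obj.map (Spec.map φ').op (chartElem k M b I hI)) : φ = φ' := by
  have h1 := congrArg (specEquiv M k A) h
  rw [specEquiv_map_chartElem, specEquiv_map_chartElem] at h1
  -- the coordinate maps agree, hence their free columns
  have h2 : (coordMapOfColumns b I fun j i => φ (chartVar k I (j, i))) =
      coordMapOfColumns b I fun j i => φ' (chartVar k I (j, i)) :=
    ofCoordMap_injective _ _ _ h1
  have h4 := congrArg (fun ψ : M →ₗ[ℤ] (Fin k → A) => fun j : {j : J // j ∉ Set.range I} => ψ (b j.1)) h2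
  simp only [restrict_coordMapOfColumns] at h4
  exact chartRing_hom_ext k I fun p => by
    have h5 := congr_fun (congr_fun h4 p.1) p.2
    exact h5

/-- **(A3.3) on affine schemes**: the chart map is injective on `Spec A`-points. [cite: StacksProject, Tag 089T] -/
theorem chartMap_app_injective_Spec (I : Fin k → J) (hI : Function.Injective I) (A : CommRingCat.{u}) :
    Function.Injective ((chartMap k M b I hI).app (op (Spec A))) := by
  intro g g' h
  obtain ⟨φ, rfl⟩ := exists_eq_specMap k I g
  obtain ⟨φ', rfl⟩ := exists_eq_specMap k I g'
  rw [chartMap_app_apply, chartMap_app_apply] at h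
  rw [specMap_injective_of_map_chartElem_eq k M b I hI h]

/-- **(A3.3) THE CHART MAP IS INJECTIVE ON `T`-POINTS** for every scheme `T`: two morphisms `T ⟶ Spec ℤ[X]` with the same pulled-back
universal element agree on every member `Spec Aᵢ` of the affine cover of `T` (affine case), hence are equal (`Scheme.Cover.hom_ext`).
[cite: StacksProject, Tag 089T] -/
theorem chartMap_app_injective (I : Fin k → J) (hI : Function.Injective I) (T : Scheme.{u}) :
    Function.Injective ((chartMap k M b I hI).app (op T)) := by
  intro g g' h
  refine Scheme.Cover.hom_ext T.affineCover g g' fun x => ?_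
  apply chartMap_app_injective_Spec k M b I hI
  rw [chartMap_app_apply, chartMap_app_apply]
  change (grassmannianSheaf M k).obj.map (Quiver.Hom.op g ≫ (T.affineCover.f x).op) (chartElem k M b I hI) =
    (grassmannianSheaf M k).obj.map (Quiver.Hom.op g' ≫ (T.affineCover.f x).op) (chartElem k M b I hI)
  rw [Functor.map_comp_apply, Functor.map_comp_apply, ← chartMap_app_apply, ← chartMap_app_apply, h]

end Injective

/-! ## §4 (A3.6) The chart maps cover the field-valued points -/

section FieldPoints

variable (k : ℕ) (M : Type u) [AddCommGroup M] {J : Type u} (b : Module.Basis J ℤ M)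

/-- **A chart point of `G(k, A ⊗ M; A)` is in the image of the chart map on `Spec A`**: if `N ∈ chart (b ∘ I) A` then
`N = specEquiv (chartMap (Spec φ))` for `φ := ` evaluation at the free columns of `coordMap N` ((C4)).
[cite: StacksProject, Tag 089T] [cite: EisenbudHarris2016, §3.2.2] -/
theorem mem_range_chartMap_app_Spec_of_mem_chart (I : Fin k → J) (hI : Function.Injective I) (A : CommRingCat.{u})
    (x : (grassmannianSheaf M k).obj.obj (op (Spec A))) (hx : specEquiv M k A x ∈ chart ℤ M k (⇑b ∘ I) A) :
    x ∈ Set.range ((chartMap k M b I hI).app (op (Spec A))) := by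
  refine ⟨Spec.map (chartRingHom k I fun p => coordMap (⇑b ∘ I) _ hx (b p.1.1) p.2), (specEquiv M k A).injective ?_⟩
  rw [specEquiv_chartMap_app_specMap]
  simp only [chartRingHom_chartVar]
  exact (ofCoordMap_congr _ (coordMapOfColumns_restrict b I hI _ (coordMap_frame _ _ hx)) _ _).trans (ofCoordMap_coordMap _ _ hx)

/-- **(A3.6) THE CHART MAPS COVER THE FIELD-VALUED POINTS of the Grassmannian sheaf**: for a field `K`, every `x ∈ Gr(Spec K)` is in the
image of `chartMap I` for some injective `I : Fin k → J` — (C5) ★ `exists_mem_chart_of_field` for the generating family `b`, then the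
affine image criterion. [cite: StacksProject, Tag 089T] -/
theorem exists_mem_range_chartMap_app_of_field (K : Type u) [Field K] (x : (grassmannianSheaf M k).obj.obj (op (Spec (CommRingCat.of K)))) :
    ∃ I : {I : Fin k → J // Function.Injective I}, x ∈ Set.range ((chartMap k M b I.1 I.2).app (op (Spec (CommRingCat.of K)))) := by
  obtain ⟨I, hI, hmem⟩ := exists_mem_chart_of_field (R := ℤ) (M := M) (k := k) (K := K) (⇑b) b.span_eq
    (specEquiv M k (CommRingCat.of K) x)
  exact ⟨⟨I, hI⟩, mem_range_chartMap_app_Spec_of_mem_chart k M b I hI (CommRingCat.of K) x hmem⟩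

end FieldPoints

end Literature.AlgebraicGeometry.Motives.Grassmannian

end
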